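import Literature.Computability.Learning.NWOutputSize
import Literature.Computability.Learning.NaturalLearningRun
import Literature.Computability.Learning.NaturalLearning
import HarnessLib

/-!
# Steps towards `cikk_natural_implies_learning`: the natural property distinguishes the learner's NW generator

Eighth instalment of the decomposition of the named fact
`Literature.Computability.Learning.cikk_natural_implies_learning` (CIKK 2016, Thm. 5.1): the
hypothesis "`D` has advantage `≥ 1/5` against the NW generator of `AMP(f)`" of the one-run
theorem `card_goodRun_ge`, discharged from the hypotheses of the fact. For `f` with a
`B₂`-circuit `C`, a level `ℓ` at which the property `R` (density `≥ 1/5`, `HasDensity 5 R`) is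
useful against size `u ℓ`, and parameters with `Q(|W| + ℓ) ≤ u ℓ` (`Q` the polynomial of
`circuitSizeOver_nwOutput_le`, `W` the hard-wired record), every NW output `g_z` has circuit
size `≤ u ℓ`, hence is rejected by `R_ℓ` (usefulness), hence the test `natTest R ℓ` has
advantage `≥ 1/5` (largeness) — CIKK, proof of Thm. 5.1, second paragraph.

* `learnerDesign q n k ℓ hn` — the design of the learner: `cikkDesign` indexed by `Fin (2^ℓ)`
  through `boolFunEquivFin`.
* `natTest_advantage_learner_ge` — the advantage statement.

## References

* M. Carmosino, R. Impagliazzo, V. Kabanets, A. Kolokolova, *Learning algorithms from natural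
  proofs*, CCC 2016, Thm. 5.1 (proof) [CarmosinoImpagliazzoKabanetsKolokolova2016].
-/

namespace Literature.Computability.Learning

open Literature.Computability.Complexity Literature.Computability.MetaComplexity
  Literature.Computability.Cryptography _root_.Computability

/-- **The natural property distinguishes the learner's NW generator with advantage `≥ 1/5`**
(CIKK, proof of Thm. 5.1: usefulness rejects every `g_z`, largeness accepts `≥ 1/5` of all
strings). Hypotheses: `R` has density `≥ 1/5` at length `ℓ`; at length `ℓ` every function with
the property has circuit size `> u ℓ`; `f` is computed by the `B₂`-circuit `C`; and the size
bound `Q(|W| + ℓ)` of `circuitSizeOver_nwOutput_le` is at most `u ℓ`.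
[cite: CarmosinoImpagliazzoKabanetsKolokolova2016, Thm. 5.1 (proof)] -/
theorem natTest_advantage_learner_ge {Q : Polynomial ℕ}
    (hQ : ∀ (n k ℓ q : ℕ) [Fact q.Prime] (hn : k * n + k ≤ q) (C : Circuit (Fin n)),
      C.IsOver B2 → ∀ (pad : List Bool) (z : Fin (q * q) → Bool),
        circuitSizeOver B2 (fun v : Fin ℓ → Bool =>
          ampFnFin (fun x => C.eval x) k (z ∘ cikkDesign q (k * n + k) ℓ hn v)) ≤
          Q.eval ((nwOutRecord (CircEval.desc C) pad q ℓ (k * n + k) n k (List.ofFn z)).length + ℓ))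
    (R : CombinatorialProperty) {ℓ : ℕ} (hR : 2 ^ (2 ^ ℓ) ≤ 5 * Nat.card (R ℓ)) {u : ℕ → ℕ}
    (hu : ∀ g ∈ R ℓ, u ℓ < circuitSizeOver B2 g) {n k q : ℕ} [Fact q.Prime] (hn : k * n + k ≤ q)
    {f : (Fin n → Bool) → Bool} (C : Circuit (Fin n)) (hC : C.IsOver B2) (hCf : C.Computes f)
    (pad : List Bool)
    (hsize : ∀ z : Fin (q * q) → Bool,
      Q.eval ((nwOutRecord (CircEval.desc C) pad q ℓ (k * n + k) n k (List.ofFn z)).length + ℓ) ≤ u ℓ) :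
    (1 / 5 : ℝ) ≤ advantage (natTest R ℓ) (nwGenerator (learnerDesign q n k ℓ hn) (ampFnFin f k)) := by
  refine natTest_advantage_ge R ℓ hR _ fun z => ?_
  rw [nwGenerator_learnerDesign_comp]
  have hf : f = fun x => C.eval x := funext fun x => (hCf x).symm
  intro hmem
  have h1 := hu _ hmem
  have h2 := hQ n k ℓ q hn C hC pad z
  rw [hf] at h1
  exact absurd (h2.trans (hsize z)) (not_le.2 h1)

end Literature.Computability.Learning
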